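import Literature.AnabelianGeometry.AbsoluteAnabelian.MonoidKummerModel

/-!
# The unit Kummer theories of the MODEL `TCG`- and `TLG`-pairs `(Π_k ↷ 𝒪_k̄^×)`, `(Π_k ↷ k̄^×)`
# ([AbsTopIII] Prop 3.3 (i) — constructed RELATIVE TO THE MODEL)

Third companion file of `MonoidKummerMaps.lean` (S. Mochizuki, *Topics in absolute anabelian geometry
III*, §3, Prop. 3.3 (i) p. 73; bib key `MochizukiAbsTopIII2015`, locators = kurims manuscript pages, lit
key `paper:url-5493eb38cbb7`).  There, Prop. 3.3 (i) is typed as the structure `UnitKummerTheory T P`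
(`T ∈ {TLG, TCG}`) over an abstract pair `P = (Π ↷ M)`: cohomology data, the cyclotome `μ_Ẑ(G)`, the CLASS
of natural isomorphisms `μ_Ẑ(M) ⥲ μ_Ẑ(G)` "only determined up to a `{±1}`- (respectively, `Ẑ^×`-) multiple
if `T = TLG` (respectively, `T = TCG`)", and the Kummer maps.  This file BUILDS it for the model pairs of
Def. 3.1 (i) (`ModelMLFGaloisData.tcgPair`, `.tlgPair` of `MLFGaloisModelPairs.lean`):

* `MLFClosure.cyclotomeSubmonoidEquiv` — for any submonoid `S ⊆ k̄` containing the roots of unity, the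
  natural map `Λ(Sˣ) → Λ(k̄ˣ) = Ẑ(1)` is an isomorphism (generalising `cyclotomeUnitsEquiv` of the first
  companion file); instances `cyclotomeUnitGroupEquiv` (`S = 𝒪_k̄^×`), `cyclotomeNonZeroDivisorsEquiv`
  (`S = k̄^×`);
* `ModelMLFGaloisData.unitKummerTheoryTCG : UnitKummerTheory .TCG D.tcgPair` — `cycIsoClass := ` ALL
  isomorphisms `Λ((𝒪_k̄^×)ˣ) ⥲ Ẑ(1)` (a torsor under `Aut(Λ) = Ẑ^×`, PROVED), Kummer maps := the Kummer classes
  of invariant units in `H¹(H, Λ(k̄ˣ))` (as in `MonoidKummerModel.lean`);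
* `ModelMLFGaloisData.unitKummerTheoryTLG : UnitKummerTheory .TLG D.tlgPair` — `cycIsoClass := {e₀, e₀ ∘ (·)⁻¹}`
  for the natural `e₀ : Λ((k̄^×)ˣ) ⥲ Ẑ(1)` (a torsor under `{±1}`, PROVED), Kummer maps likewise;
* non-vacuity: `nonempty_unitKummerTheory_tcgPair`, `nonempty_unitKummerTheory_tlgPair`.

As in `MonoidKummerModel.lean`, `μ_Ẑ(G)` (Cor. 1.10 (a), seat abc-iut-L4-t1) is played by the
field-theoretic `Ẑ(1) = Λ(k̄ˣ)` and `H²` is not modelled.  The structure `UnitKummerTheory` imposes no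
axiom on its Kummer-map fields; they are nevertheless the genuine Kummer classes here.  Prop. 3.3 (ii)
(`UnitPairIsoFibres`) is not touched (seat abc-iut-L6-t21 holds its first conjunct).
HONEST FRAMING: OUR kernel constructions of classical objects named by a refereed paper; nothing here
bears on [IUTchIII] Cor. 3.12.
-/

noncomputable section

universe u

namespace Literature.AnabelianGeometry.AbsoluteAnabelian

open _root_.Topology
open scoped _root_.ValuativeRel nonZeroDivisors
open Literature.AnabelianGeometry.EtaleTheta (cyclotomeRep kummerClass invariants)

/-! ### `Λ(Sˣ) ⥲ Ẑ(1)` for submonoids `S ⊆ k̄` containing the roots of unity -/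

section Cyclotome

variable (C : MLFClosure.{u})

namespace MLFClosure

variable (S : Submonoid C.K)

/-- A root of unity `z ∈ k̄ˣ` as a unit of a submonoid `S ⊆ k̄` containing the roots of unity (its inverse is
again a root of unity). [cite: MochizukiAbsTopIII2015, Definition 3.1 (v) p.69] -/
def rootOfUnityUnitIn (hS : ∀ (z : C.K) (n : ℕ), 0 < n → z ^ n = 1 → z ∈ S)
    (z : (C.K)ˣ) {n : ℕ} (hn : 0 < n) (hz : z ^ n = 1) : Sˣ where
  val := ⟨(z : C.K), hS _ n hn (by rw [← Units.val_pow_eq_pow_val, hz, Units.val_one])⟩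
  inv := ⟨((z⁻¹ : (C.K)ˣ) : C.K), hS _ n hn (by
    rw [← Units.val_pow_eq_pow_val, inv_pow, hz, inv_one, Units.val_one])⟩
  val_inv := Subtype.ext (by simp)
  inv_val := Subtype.ext (by simp)

/-- The natural map `Λ(Sˣ) → Λ(k̄ˣ)` induced by `S ⊆ k̄`. [cite: MochizukiAbsTopIII2015, Remark 3.2.1 p.72] -/
def cyclotomeSubmonoidHom : cyclotome S →* EtaleTheta.cyclotome (C.K)ˣ :=
  EtaleTheta.cyclotome.map (Units.map S.subtype)

/-- Components of `cyclotomeSubmonoidHom`. [cite: MochizukiAbsTopIII2015, Remark 3.2.1 p.72] -/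
@[simp] theorem coe_cyclotomeSubmonoidHom_apply (ζ : cyclotome S) (n : ℕ+) :
    (((C.cyclotomeSubmonoidHom S ζ : EtaleTheta.cyclotome (C.K)ˣ) : ℕ+ → (C.K)ˣ) n : C.K) =
      (((ζ : ℕ+ → Sˣ) n : S) : C.K) := rfl

/-- `Λ(Sˣ) → Λ(k̄ˣ)` is bijective when `S` contains the roots of unity.
[cite: MochizukiAbsTopIII2015, Remark 3.2.1 p.72] -/
theorem cyclotomeSubmonoidHom_bijective (hS : ∀ (z : C.K) (n : ℕ), 0 < n → z ^ n = 1 → z ∈ S) :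
    Function.Bijective (C.cyclotomeSubmonoidHom S) := by
  constructor
  · intro ζ ξ h
    refine Subtype.ext (funext fun n => Units.ext (Subtype.ext ?_))
    have := congrArg (fun η : EtaleTheta.cyclotome (C.K)ˣ => (((η : ℕ+ → (C.K)ˣ) n : (C.K)ˣ) : C.K)) h
    simpa using this
  · intro ζ
    refine ⟨⟨fun n => C.rootOfUnityUnitIn S hS ((ζ : ℕ+ → (C.K)ˣ) n) n.pos (ζ.2.1 n), ?_, ?_⟩, ?_⟩
    · intro n
      refine Units.ext (Subtype.ext ?_)
      have h := congrArg (fun u : (C.K)ˣ => (u : C.K)) (ζ.2.1 n)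
      simpa [rootOfUnityUnitIn, Units.val_pow_eq_pow_val] using h
    · intro n m
      refine Units.ext (Subtype.ext ?_)
      have h := congrArg (fun u : (C.K)ˣ => (u : C.K)) (ζ.2.2 n m)
      simpa [rootOfUnityUnitIn, Units.val_pow_eq_pow_val] using h
    · exact Subtype.ext (funext fun n => Units.ext rfl)

/-- `Λ(Sˣ) ⥲ Λ(k̄ˣ) = Ẑ(1)` for a submonoid `S ⊆ k̄` containing the roots of unity (the cyclotome of an
MLF-Galois `T`-pair, `T ∈ {TLG, TCG, TM}`, "is isomorphic to `Ẑ`" — here: to `Ẑ(1)`).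
[cite: MochizukiAbsTopIII2015, Definition 3.1 (v) p.69] -/
def cyclotomeSubmonoidEquiv (hS : ∀ (z : C.K) (n : ℕ), 0 < n → z ^ n = 1 → z ∈ S) :
    cyclotome S ≃* EtaleTheta.cyclotome (C.K)ˣ :=
  MulEquiv.ofBijective (C.cyclotomeSubmonoidHom S) (C.cyclotomeSubmonoidHom_bijective S hS)

/-- Roots of unity are units of `𝒪_k̄`. [cite: MochizukiAbsTopIII2015, Definition 3.1 (i) p.66] -/
theorem mem_unitSubmonoid_of_pow_eq_one' (z : C.K) (n : ℕ) (hn : 0 < n) (hz : z ^ n = 1) :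
    z ∈ unitSubmonoid C.k C.K := by
  refine ⟨(C.mem_nonzeroIntegers_of_pow_eq_one hn hz).1, z ^ (n - 1),
    Subalgebra.pow_mem _ (C.mem_nonzeroIntegers_of_pow_eq_one hn hz).1 _, ?_⟩
  rw [← pow_succ', Nat.sub_add_cancel hn, hz]

/-- Roots of unity are non-zero. [cite: MochizukiAbsTopIII2015, Definition 3.1 (i) p.67] -/
theorem mem_nonZeroDivisors_of_pow_eq_one (z : C.K) (n : ℕ) (hn : 0 < n) (hz : z ^ n = 1) :
    z ∈ (C.K)⁰ :=
  mem_nonZeroDivisors_iff_ne_zero.mpr (C.mem_nonzeroIntegers_of_pow_eq_one hn hz).2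

/-- `μ_Ẑ(𝒪_k̄^×) = Λ((𝒪_k̄^×)ˣ) ⥲ Ẑ(1)` (cyclotome of the model `TCG`-pair). [cite: MochizukiAbsTopIII2015, Definition 3.1 (v) p.69] -/
def cyclotomeUnitGroupEquiv : cyclotome (unitSubmonoid C.k C.K) ≃* EtaleTheta.cyclotome (C.K)ˣ :=
  C.cyclotomeSubmonoidEquiv _ C.mem_unitSubmonoid_of_pow_eq_one'

/-- `μ_Ẑ(k̄^×) = Λ((k̄^×)ˣ) ⥲ Ẑ(1)` (cyclotome of the model `TLG`-pair). [cite: MochizukiAbsTopIII2015, Definition 3.1 (v) p.69] -/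
def cyclotomeNonZeroDivisorsEquiv : cyclotome (C.K)⁰ ≃* EtaleTheta.cyclotome (C.K)ˣ :=
  C.cyclotomeSubmonoidEquiv _ C.mem_nonZeroDivisors_of_pow_eq_one

end MLFClosure

end Cyclotome

/-! ### Prop 3.3 (i) for the model `TCG`- and `TLG`-pairs -/

section UnitKummer

variable (C : MLFClosure.{0}) (D : ModelMLFGaloisData C.k C.K)

namespace ModelMLFGaloisData

/-- The unit of `k̄` underlying `m ∈ 𝒪_k̄^×`. [cite: MochizukiAbsTopIII2015, Definition 3.1 (i) p.66] -/
def tcgToUnit (m : unitSubmonoid C.k C.K) : (C.K)ˣ :=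
  Units.mk0 (m : C.K) (unitSubmonoid_le_nonzeroIntegers m.2).2

/-- The unit of `k̄` underlying `m ∈ k̄^×`. [cite: MochizukiAbsTopIII2015, Definition 3.1 (i) p.67] -/
def tlgToUnit (m : (C.K)⁰) : (C.K)ˣ := Units.mk0 (m : C.K) (mem_nonZeroDivisors_iff_ne_zero.mp m.2)

/-- `tcgToUnit` is `Π_k`-equivariant. [cite: MochizukiAbsTopIII2015, Definition 3.1 (i) p.67] -/
theorem smul_tcgToUnit (g : D.Pi) (m : unitSubmonoid C.k C.K) :
    g • tcgToUnit C m = tcgToUnit C (g • m) := Units.ext rfl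

/-- `tlgToUnit` is `Π_k`-equivariant. [cite: MochizukiAbsTopIII2015, Definition 3.1 (i) p.67] -/
theorem smul_tlgToUnit (g : D.Pi) (m : (C.K)⁰) :
    g • tlgToUnit C m = tlgToUnit C (g • m) := Units.ext rfl

/-- The `H`-invariant unit underlying an `H`-invariant element of `𝒪_k̄^×`.
[cite: MochizukiAbsTopIII2015, Proposition 3.3 (i) p.73] -/
def tcgInvariantUnit (H : OpenSubgroup D.tcgPair.Pi)
    (m : {m : D.tcgPair.M // ∀ h : H, (h : D.tcgPair.Pi) • m = m}) :
    invariants (A := (C.K)ˣ) (H : Subgroup D.Pi) :=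
  ⟨tcgToUnit C m.1, fun h => by
    change (h : D.Pi) • tcgToUnit C m.1 = tcgToUnit C m.1
    rw [D.smul_tcgToUnit, m.2 ⟨h.1, h.2⟩]⟩

/-- The `H`-invariant unit underlying an `H`-invariant element of `k̄^×`.
[cite: MochizukiAbsTopIII2015, Proposition 3.3 (i) p.73] -/
def tlgInvariantUnit (H : OpenSubgroup D.tlgPair.Pi)
    (m : {m : D.tlgPair.M // ∀ h : H, (h : D.tlgPair.Pi) • m = m}) :
    invariants (A := (C.K)ˣ) (H : Subgroup D.Pi) :=
  ⟨tlgToUnit C m.1, fun h => by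
    change (h : D.Pi) • tlgToUnit C m.1 = tlgToUnit C m.1
    rw [D.smul_tlgToUnit, m.2 ⟨h.1, h.2⟩]⟩

/-- The open stabiliser of `m ∈ 𝒪_k̄^×`. [cite: MochizukiAbsTopIII2015, Proposition 3.3 (i) p.73] -/
def tcgStabilizerOpen (m : D.tcgPair.M) : OpenSubgroup D.tcgPair.Pi :=
  ⟨MulAction.stabilizer D.Pi m, D.tcgPair.isOpen_stabilizer m⟩

/-- The open stabiliser of `m ∈ k̄^×`. [cite: MochizukiAbsTopIII2015, Proposition 3.3 (i) p.73] -/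
def tlgStabilizerOpen (m : D.tlgPair.M) : OpenSubgroup D.tlgPair.Pi :=
  ⟨MulAction.stabilizer D.Pi m, D.tlgPair.isOpen_stabilizer m⟩

/-- **Prop 3.3 (i) for the model `TCG`-pair `(Π_k ↷ 𝒪_k̄^×)` — `UnitKummerTheory .TCG` BUILT.**  The class of
isomorphisms `μ_Ẑ(𝒪_k̄^×) ⥲ μ_Ẑ(G)` "only determined up to a `Ẑ^×`-multiple" is the set of ALL isomorphisms
`Λ((𝒪_k̄^×)ˣ) ⥲ Ẑ(1)` (non-empty by `cyclotomeUnitGroupEquiv`; any two differ by an automorphism of the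
cyclotome); the Kummer maps are the Kummer classes of invariant units in `H¹(H, Λ(k̄ˣ))`.
[cite: MochizukiAbsTopIII2015, Proposition 3.3 (i) p.73] -/
def unitKummerTheoryTCG : UnitKummerTheory .TCG D.tcgPair where
  coh := D.kummerCohomology C
  muG := EtaleTheta.cyclotome (C.K)ˣ
  cycIsoClass := Set.univ
  cycIsoClass_nonempty := ⟨C.cyclotomeUnitGroupEquiv, trivial⟩
  cycIsoClass_torsor e₁ _ e₂ _ :=
    ⟨e₂.trans e₁.symm, fun h => PairType.noConfusion h, fun ζ => (e₁.apply_symm_apply (e₂ ζ)).symm⟩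
  cycIsoClass_full e₁ _ u _ := ⟨u.trans e₁, trivial, fun _ => rfl⟩
  kummer H m := kummerClass (A := (C.K)ˣ) (G := D.Pi) (H : Subgroup D.Pi) (D.tcgInvariantUnit C H m)
  kummerLim m := Quot.mk _ ⟨D.tcgStabilizerOpen C m,
    kummerClass (A := (C.K)ˣ) (G := D.Pi) (D.tcgStabilizerOpen C m : Subgroup D.Pi)
      (D.tcgInvariantUnit C (D.tcgStabilizerOpen C m)
        ⟨m, fun h => MulAction.mem_stabilizer_iff.mp h.2⟩)⟩

/-- **Prop 3.3 (i) for the model `TLG`-pair `(Π_k ↷ k̄^×)` — `UnitKummerTheory .TLG` BUILT.**  The class of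
isomorphisms `μ_Ẑ(k̄^×) ⥲ μ_Ẑ(G)` "only determined up to a `{±1}`-multiple" is `{e₀, e₀ ∘ (·)⁻¹}` for the
natural `e₀ = cyclotomeNonZeroDivisorsEquiv : Λ((k̄^×)ˣ) ⥲ Ẑ(1)` (a torsor under `{id, inversion}`,
PROVED); the Kummer maps are the Kummer classes of invariant units in `H¹(H, Λ(k̄ˣ))`.
[cite: MochizukiAbsTopIII2015, Proposition 3.3 (i) p.73] -/
def unitKummerTheoryTLG : UnitKummerTheory .TLG D.tlgPair where
  coh := D.kummerCohomology C
  muG := EtaleTheta.cyclotome (C.K)ˣ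
  cycIsoClass := {C.cyclotomeNonZeroDivisorsEquiv,
    (MulEquiv.inv (cyclotome (C.K)⁰)).trans C.cyclotomeNonZeroDivisorsEquiv}
  cycIsoClass_nonempty := ⟨C.cyclotomeNonZeroDivisorsEquiv, Or.inl rfl⟩
  cycIsoClass_torsor e₁ he₁ e₂ he₂ := by
    rcases he₁ with rfl | rfl <;> rcases he₂ with rfl | rfl
    · exact ⟨MulEquiv.refl _, fun _ => Or.inl rfl, fun _ => rfl⟩
    · exact ⟨MulEquiv.inv _, fun _ => Or.inr rfl, fun _ => rfl⟩
    · exact ⟨MulEquiv.inv _, fun _ => Or.inr rfl, fun ζ => by simp⟩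
    · exact ⟨MulEquiv.refl _, fun _ => Or.inl rfl, fun _ => rfl⟩
  cycIsoClass_full e₁ he₁ u hu := by
    refine ⟨u.trans e₁, ?_, fun _ => rfl⟩
    rcases he₁ with rfl | rfl <;> rcases hu rfl with rfl | rfl
    · exact Or.inl rfl
    · exact Or.inr rfl
    · exact Or.inr rfl
    · refine Or.inl (MulEquiv.ext fun ζ => ?_)
      simp
  kummer H m := kummerClass (A := (C.K)ˣ) (G := D.Pi) (H : Subgroup D.Pi) (D.tlgInvariantUnit C H m)
  kummerLim m := Quot.mk _ ⟨D.tlgStabilizerOpen C m,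
    kummerClass (A := (C.K)ˣ) (G := D.Pi) (D.tlgStabilizerOpen C m : Subgroup D.Pi)
      (D.tlgInvariantUnit C (D.tlgStabilizerOpen C m)
        ⟨m, fun h => MulAction.mem_stabilizer_iff.mp h.2⟩)⟩

/-- The `TCG` Kummer map of the model at level `H`, unfolded. [cite: MochizukiAbsTopIII2015, Proposition 3.3 (i) p.73] -/
theorem unitKummerTheoryTCG_kummer (H : OpenSubgroup D.tcgPair.Pi)
    (m : {m : D.tcgPair.M // ∀ h : H, (h : D.tcgPair.Pi) • m = m}) :
    (D.unitKummerTheoryTCG C).kummer H m =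
      kummerClass (A := (C.K)ˣ) (G := D.Pi) (H : Subgroup D.Pi) (D.tcgInvariantUnit C H m) :=
  rfl

/-- The `TLG` Kummer map of the model at level `H`, unfolded. [cite: MochizukiAbsTopIII2015, Proposition 3.3 (i) p.73] -/
theorem unitKummerTheoryTLG_kummer (H : OpenSubgroup D.tlgPair.Pi)
    (m : {m : D.tlgPair.M // ∀ h : H, (h : D.tlgPair.Pi) • m = m}) :
    (D.unitKummerTheoryTLG C).kummer H m =
      kummerClass (A := (C.K)ˣ) (G := D.Pi) (H : Subgroup D.Pi) (D.tlgInvariantUnit C H m) :=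
  rfl

end ModelMLFGaloisData

/-- **Non-vacuity of `UnitKummerTheory .TCG`** on MLF-Galois `TCG`-pairs. [cite: MochizukiAbsTopIII2015, Proposition 3.3 (i) p.73] -/
theorem nonempty_unitKummerTheory_tcgPair : Nonempty (UnitKummerTheory .TCG D.tcgPair) :=
  ⟨D.unitKummerTheoryTCG C⟩

/-- **Non-vacuity of `UnitKummerTheory .TLG`** on MLF-Galois `TLG`-pairs. [cite: MochizukiAbsTopIII2015, Proposition 3.3 (i) p.73] -/
theorem nonempty_unitKummerTheory_tlgPair : Nonempty (UnitKummerTheory .TLG D.tlgPair) :=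
  ⟨D.unitKummerTheoryTLG C⟩

end UnitKummer

end Literature.AnabelianGeometry.AbsoluteAnabelian

end
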